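import Summits.ResolutionOfSingularities.ResolutionOfSingularities.Theses.TeissierJung
import Literature.AlgebraicGeometry.Resolution.TeissierPresentation

/-!
# `TeissierReduction` (crux stmt-ResolutionOfSingularities-17085, route `TeissierJung`):
# the hypothesis `IsIntegral H` is load-bearing — weakened to `IsReduced H` the statement is FALSE
# (negative-side support, refuter crux-disprover seat; this file does NOT refute the crux)

`TeissierReduction` concludes with `∃ X' (ρ : X' ⟶ H), IsProper ρ ∧ IsBirational ρ ∧ TF X'`, and
the Teissier predicate `TF X'` contains `IsIntegral X'`; a scheme mapping to `H` is empty when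
`H` is, so the conclusion forces `H` to be nonempty. The EMPTY closed subscheme `∅ ↪ ℙ⁰_k` is
reduced, its ideal sheaf is `⊤` (principal on every affine open), and it has no integral scheme
over it (cf. the empty witness of `SigmaMaxModifications/Negative/LoadBearing.lean`). Hence:

* `teissierReduction_false_without_isIntegral` — the text of the crux with `IsIntegral H`
  replaced by `IsReduced H` (everything else byte-identical, the let-bound `TF` included) is
  false; witness `p = 2`, `k = \overline{𝔽₂}`, `m = 0`, `H = ∅`.

Moral for provers: integrality of `H` (at least `H ≠ ∅`; irreducibility is what makes a proper
birational `X' → H` with integral `X'` possible at all) must be used; reducedness alone, which is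
all the summit statement `ResolutionInChar` assumes of its schemes, does not suffice for THIS
formulation — the reduction from reduced to integral schemes is carried by the separate item
`HypersurfacesSuffice` of the route, not by the crux.
-/

noncomputable section

set_option linter.dupNamespace false

namespace Summit.ResolutionOfSingularities.ResolutionOfSingularities.Theorems.TeissierReduction.Negative

open CategoryTheory AlgebraicGeometry IsLocalRing
open Literature.AlgebraicGeometry.Resolution

/-- **`IsIntegral H` is load-bearing in `TeissierReduction`.** The crux with `IsIntegral H`
weakened to `IsReduced H` (verbatim otherwise) fails: at `p = 2`, `k` an algebraic closure of
`𝔽₂`, `m = 0` and `H = ∅ ↪ ℙ⁰_k` (a closed immersion with ideal `⊤`, principal on every affine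
open; `∅` is reduced), the conclusion would give an integral — in particular nonempty — scheme
`X'` with a morphism `X' → ∅`. [folklore] -/
theorem teissierReduction_false_without_isIntegral :
    ¬ (∀ p : ℕ, p.Prime → ∀ (k : Type) [Field k] [CharP k p] [IsAlgClosed k], let TF : AlgebraicGeometry.Scheme.{0} → Prop := fun X' => (∃ (S : AlgebraicGeometry.Scheme.{0}) (g : S ⟶ AlgebraicGeometry.Spec (.of k)) (π : X' ⟶ S), AlgebraicGeometry.IsSeparated g ∧ AlgebraicGeometry.LocallyOfFiniteType g ∧ AlgebraicGeometry.QuasiCompact g ∧ AlgebraicGeometry.IsIntegral S ∧ Literature.AlgebraicGeometry.Resolution.Scheme.IsRegular S ∧ AlgebraicGeometry.IsIntegral X' ∧ AlgebraicGeometry.IsFinite π ∧ ∀ x : X', IsClosed ({x} : Set X') → ∀ P ∈ minimalPrimes (AdicCompletion (IsLocalRing.maximalIdeal (X'.presheaf.stalk x)) (X'.presheaf.stalk x)), ∃ (d g : ℕ) (n : Fin g → ℕ) (v : Fin g → (Fin d → ℚ)) (c : Fin g → k) (A : Fin g → (Fin d →₀ ℕ)) (mu : Fin g → (Fin g →₀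 ℕ)) (h : Fin g → MvPolynomial (Fin g) (MvPowerSeries (Fin d) k)) (φ : AdicCompletion (IsLocalRing.maximalIdeal (S.presheaf.stalk (π.base x))) (S.presheaf.stalk (π.base x)) ≃+* MvPowerSeries (Fin d) k), let W : (Fin d →₀ ℕ) → (Fin g →₀ ℕ) → (Fin d → ℚ) := fun a e j => (a j : ℚ) + ∑ i : Fin g, (e i : ℚ) * v i j; let core : Fin g → MvPolynomial (Fin g) (MvPowerSeries (Fin d) k) := fun i => MvPolynomial.X i ^ (n i) - MvPolynomial.C (MvPowerSeries.monomial (A i) (c i)) * MvPolynomial.monomial (mu i) 1 + h i; let E : Fin g → MvPolynomial (Fin g) (MvPowerSeries (Fin d) k) := fun i => if hi : i.val + 1 < g then MvPolynomial.X ⟨i.val + 1, hi⟩ - core i else core i; let B : Fin g → MvPolynomial (Fin d ⊕ Fin g) k := fun i => MvPolynomial.X (Sum.inr i) ^ (n i) - MvPolynomial.C (c i) * MvPolynomial.monomial ((A i).sumElim (mu i)) 1; ∃ ψ : (AdicCompletion (IsLocalRing.maximalIdeal (X'.presheaf.stalk x)) (X'.presheaf.stalk x) ⧸ P) ≃+*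 (MvPolynomial (Fin g) (MvPowerSeries (Fin d) k) ⧸ Ideal.span (Set.range E)), (∀ i, 2 ≤ n i) ∧ (∀ i, c i ≠ 0) ∧ (∀ i j, 0 ≤ v i j) ∧ (∀ i (j : Fin g), i.val ≤ j.val → mu i j = 0) ∧ (∀ i, n i • v i = W (A i) (mu i)) ∧ (∀ (i : Fin g) (hi : i.val + 1 < g), n i • v i ≤ v ⟨i.val + 1, hi⟩ ∧ n i • v i ≠ v ⟨i.val + 1, hi⟩) ∧ (∀ i, ∀ e ∈ (h i).support, (∀ j : Fin g, i.val + 1 < j.val → e j = 0) ∧ ∀ a : Fin d →₀ ℕ, MvPowerSeries.coeff a ((h i).coeff e) ≠ 0 → n i • v i ≤ W a e ∧ n i • v i ≠ W a e) ∧ (Ideal.span (Set.range B)).IsPrime ∧ (∀ a : S.presheaf.stalk (π.base x), ψ (Ideal.Quotient.mk P (algebraMap _ _ ((π.stalkMap x).hom a))) = Ideal.Quotient.mk _ (MvPolynomial.C (φ (algebraMap _ _ a))))); ∀ (m : ℕ) (H : AlgebraicGeometry.Scheme.{0}) (ι' : H ⟶ (Literature.AlgebraicGeometry.Motives.projectiveSpace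 m k).left), AlgebraicGeometry.IsClosedImmersion ι' → AlgebraicGeometry.IsReduced H → (∀ y : (Literature.AlgebraicGeometry.Motives.projectiveSpace m k).left, ∃ U : (Literature.AlgebraicGeometry.Motives.projectiveSpace m k).left.affineOpens, y ∈ (U : (Literature.AlgebraicGeometry.Motives.projectiveSpace m k).left.Opens) ∧ (ι'.ker.ideal U).IsPrincipal) → ∃ (X' : AlgebraicGeometry.Scheme.{0}) (ρ : X' ⟶ H), AlgebraicGeometry.IsProper ρ ∧ Literature.AlgebraicGeometry.Resolution.IsBirational ρ ∧ TF X') := by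
  intro h
  -- `∅` is reduced (vacuously: it has no stalks)
  have hred : IsReduced (∅ : Scheme.{0}) :=
    haveI : ∀ x : (∅ : Scheme.{0}), _root_.IsReduced ((∅ : Scheme.{0}).presheaf.stalk x) :=
      fun x => isEmptyElim x
    isReduced_of_isReduced_stalk _
  obtain ⟨X', ρ, -, -, hTF⟩ := h 2 Nat.prime_two (AlgebraicClosure (ZMod 2)) 0 ∅
    (Scheme.emptyTo _) inferInstance hred (fun y => by
      obtain ⟨_, ⟨V, hV, rfl⟩, hyV, -⟩ :=
        (Literature.AlgebraicGeometry.Motives.projectiveSpace 0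
          (AlgebraicClosure (ZMod 2))).left.isBasis_affineOpens.exists_subset_of_mem_open
          (Set.mem_univ y) isOpen_univ
      refine ⟨⟨V, hV⟩, hyV, ?_⟩
      rw [Scheme.ker_eq_top_of_isEmpty, Scheme.IdealSheafData.ideal_top]
      exact top_isPrincipal)
  have hint : IsIntegral X' :=
    ((teissierPresented_iff (AlgebraicClosure (ZMod 2)) X').2 hTF).isIntegral
  obtain ⟨x⟩ := hint.nonempty
  exact isEmptyElim (ρ.base x)

end Summit.ResolutionOfSingularities.ResolutionOfSingularities.Theorems.TeissierReduction.Negative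

end
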